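import Literature.Computability.QuantumComplexity.SignedForrelationMemSpec
import Literature.Computability.QuantumComplexity.SignedForrelationGadget
import Literature.Computability.QuantumComplexity.ForrelationMemValue
import HarnessLib

/-!
# Signed 2-fold Forrelation is in `PromiseBQP`, II: the phase machine on genuine codes

Second machine file (after `SignedForrelationMemSpec.lean`). On the code `x = ⟨bin n, ⟨bin k, [C₀, …]⟩⟩`
of an instance `I` (`KForrelationInstance.encode`) with `k = 2` the models of the specification
`specS` compute what they should:

* `Kv x = 4`, `Wv x = W_d + 1` with `W_d = WdS I = min(n, #R + 1) + [n odd]` (`Wv_encode`);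
* the evaluator brick returns `Cᵢ(assign u)` (`cbitM_encode`, from `ForrelationMemCorrect.lean`);
* **the phase predicate of layer `j` on a register `y`** is `[j ≤ 3] ∧ gS I j (y|_{W_d + 1})`
  (`PfS_encode`), where `gS I 1 = ctl (C₀ ⊕ C₁(0))`, `gS I 2 = dat (C₁ ⊕ q)`, `gS I 3 = ctl q` are the
  gadget predicates of `SignedForrelationGadget.lean` for the circuits read through the rank layout
  (`ForrMem.ext`) and the inner product `q` of the two halves of the data wires (`qW`);
* hence **the return amplitude of the family on `x` is the 3-fold forrelation of the gadget
  predicates** on `W_d + 1` wires (`phiFin_encode`, by `PhaseQuery.phiFin_zero_eq_kForrelationValue`).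

## References

* S. Aaronson, A. Ambainis, *Forrelation*, SIAM J. Comput. 47 (2018), §3.2 Prop. 6, §6 (p. 26)
  [AaronsonAmbainis2018].
* S. Arora, B. Barak, *Computational Complexity: A Modern Approach*, CUP 2009, Thm. 6.18 (proof)
  [AroraBarak2009].
-/

noncomputable section

namespace Literature.Computability.QuantumComplexity

open _root_.Computability Complexity Complexity.Brick Cryptography PhaseQuery

namespace SgnForrMem

open ForrMem

variable (I : KForrelationInstance)

/-! ### Sizes on an instance code -/

/-- **The number of data wires of an instance**: `W_d = min(n, #R + 1) + [n odd]`. [cite: AaronsonAmbainis2018, §6 (p. 26)] -/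
def WdS : ℕ := min I.n (sR I + 1) + if Even I.n then 0 else 1

/-- `#R` is read off the code. [folklore] -/
theorem lenR_encode : lenR I.encode = sR I := by rw [lenR, dedupVals_occAll_encode]

/-- `n` is read off the code. [folklore] -/
theorem n_encode : bitsToNat (fstF I.encode) = I.n := by rw [(sndF_sndF_encode I).2.1, bitsToNat_encodeNat]

/-- **`wdNat x = W_d`.** [folklore] -/
theorem wdNat_encode : wdNat I.encode = WdS I := by rw [wdNat, lenR_encode, n_encode]; rfl

/-- **`Wv x = W_d + 1`.** [folklore] -/
theorem Wv_encode : specS.Wv I.encode = WdS I + 1 := by rw [(Kv_Wv _).2, wdNat_encode]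

/-- **`Kv x = 3 + 1`.** [folklore] -/
theorem Kv_encode : specS.Kv I.encode = 3 + 1 := (Kv_Wv _).1

/-- `W_d ≤ #R + 2`. [folklore] -/
theorem WdS_le : WdS I ≤ sR I + 2 := by unfold WdS; split_ifs <;> omega

/-- `#R ≤ W_d`. [folklore] -/
theorem sR_le_WdS : sR I ≤ WdS I := by
  have h : (Rl I).length ≤ I.n := length_Rl_le I
  show (Rl I).length ≤ WdS I
  unfold WdS; dsimp only [sR]; split_ifs <;> omega

/-- `W_d + 1 ≤ Wq = |x| + 8`: the active wires fit in a query register. [folklore] -/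
theorem WdS_lt_Wq : WdS I + 1 ≤ Wq paramsS I.encode.length := by
  rw [(Ly_paramsS _).2]; have := sR_le_length I; have := WdS_le I; omega

/-- `4 ≤ |x|`. [folklore] -/
theorem four_le_length : 4 ≤ I.encode.length := by
  rw [KForrelationInstance.encode, length_boolPair, length_boolPair]; omega

/-- `3 ≤ Ly = |x|`: the three phase layers fit. [folklore] -/
theorem three_le_Ly : 3 ≤ Ly paramsS I.encode.length := by rw [(Ly_paramsS _).1]; have := four_le_length I; omega

/-! ### The evaluator on codes -/

/-- **The evaluator brick returns `Cᵢ(assign u)`.** [cite: AroraBarak2009, Thm. 6.18 (proof)] -/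
theorem cbitM_encode (u : List Bool) (i : Fin I.k) : cbitM I.encode u i = (I.C i).eval (assign I u) := by
  have hsel : fstF (sndF^[(i : ℕ)] (sndF (sndF I.encode))) = encodeCircuit (I.C i) := by
    have h := circuit_select I (j := (i : ℕ) + 1) (by omega) (by have := i.isLt; omega)
    simpa using h
  simp only [cbitM, dedupVals_occAll_encode, hsel]
  rw [encodeCircuit, fstF_boolPair, sndF_boolPair, encodeCodeList_eq_encList, decNil_encList, evalGatesM_map_encodeGate,
    wireBit_encodeWire, eval_eq_wireVal]

/-- The empty register is the all-zero assignment. [folklore] -/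
theorem assign_nil : assign I [] = fun _ => false := by funext i; simp [assign]

/-- **Circuit `i` read through the rank layout** on `m` data wires (`false` beyond `k`). [folklore] -/
def cfun (i : ℕ) {m : ℕ} (w : Fin m → Bool) : Bool := if h : i < I.k then (I.C ⟨i, h⟩).eval (ext I w) else false

/-- **The bent bit on the data wires**: the inner product of the two halves. [folklore] -/
def qW (w : Fin (WdS I) → Bool) : Bool := qM (WdS I / 2) (List.ofFn w)

/-- **The gadget predicates of the instance** on `W_d + 1` wires: layer 1 `c ∧ (C₀ ⊕ C₁(0))`, layer 2
`C₁ ⊕ q`, layer 3 `c ∧ q`, nothing on other layers. [cite: AaronsonAmbainis2018, §3.2 Prop. 6] -/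
def gS (j : ℕ) : (Fin (WdS I + 1) → Bool) → Bool :=
  match j with
  | 1 => ctl fun w => xor (cfun I 0 w) (cfun I 1 fun _ : Fin (WdS I) => false)
  | 2 => dat fun w => xor (cfun I 1 w) (qW I w)
  | 3 => ctl (qW I)
  | _ => fun _ => false

/-! ### Reading a register -/

section Register

variable (y : QReg (Wq paramsS I.encode.length))

/-- The data wires of a register content: the first `W_d` bits. [folklore] -/
def dataW : Fin (WdS I) → Bool := Fin.init (y ∘ Fin.castLE (WdS_lt_Wq I))

/-- A bit of `List.ofFn y` inside the register. [folklore] -/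
theorem getD_ofFn {p : ℕ} (hp : p < Wq paramsS I.encode.length) : (List.ofFn y).getD p false = y ⟨p, hp⟩ := by
  rw [List.getD_eq_getElem _ _ (by simpa using hp)]; simp

/-- **The control bit** is the last active wire. [folklore] -/
theorem getD_ofFn_WdS : (List.ofFn y).getD (WdS I) false = (y ∘ Fin.castLE (WdS_lt_Wq I)) (Fin.last (WdS I)) := by
  rw [getD_ofFn I y (WdS_lt_Wq I)]; rfl

/-- **The circuits read the data wires**: `Cᵢ(assign (ofFn y)) = cfun I i (data wires)`. [folklore] -/
theorem cbitM_ofFn (i : Fin I.k) : cbitM I.encode (List.ofFn y) i = cfun I i (dataW I y) := by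
  rw [cbitM_encode, cfun, dif_pos i.isLt]
  refine eval_congr_reads _ fun i' hi' => ?_
  have hr := rank_lt_of_mem I (mem_occList_of_mem_readsC I i hi')
  have hrW : rank I i' < WdS I := lt_of_lt_of_le hr (sR_le_WdS I)
  rw [assign, getD_ofFn I y (lt_of_lt_of_le hrW (by have := WdS_lt_Wq I; omega)), ext, dif_pos hrW]
  rfl

/-- The circuits on the empty register: `Cᵢ(0…0) = cfun I i 0`. [folklore] -/
theorem cbitM_nil (i : Fin I.k) {m : ℕ} : cbitM I.encode [] i = cfun I i (fun _ : Fin m => false) := by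
  rw [cbitM_encode, cfun, dif_pos i.isLt, assign_nil]
  congr 1
  funext i'
  simp [ext]

/-- The bent bit only reads the first `t + t` bits. [folklore] -/
theorem qM_take {t M : ℕ} (h : t + t ≤ M) (l : List Bool) : qM t (l.take M) = qM t l := by
  unfold qM
  rw [List.take_take, min_eq_left (by omega), List.drop_take, List.take_take, min_eq_left (by omega)]

/-- The data wires as a list: the first `W_d` entries of the register. [folklore] -/
theorem ofFn_dataW : List.ofFn (dataW I y) = (List.ofFn y).take (WdS I) := by
  apply List.ext_getElem
  · simp; have := WdS_lt_Wq I; omega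
  · intro p h1 h2
    simp [dataW, Fin.init]

/-- **The bent bit of the register is the bent bit of the data wires.** [folklore] -/
theorem qM_ofFn : qM (WdS I / 2) (List.ofFn y) = qW I (dataW I y) := by
  rw [qW, ofFn_dataW, qM_take (by omega)]

end Register

/-! ### The phase predicate on codes -/

/-- **The phase bit of layer `j` on a register**, for a two-circuit instance. [cite: AaronsonAmbainis2018, §3.2 Prop. 6] -/
theorem phaseBitS_encode (hk : I.k = 2) (y : QReg (Wq paramsS I.encode.length)) (j : ℕ) :
    phaseBitS I.encode (List.ofFn y) j = (decide (j ≤ 3) && gS I j (y ∘ Fin.castLE (WdS_lt_Wq I))) := by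
  have i0 : 0 < I.k := by omega
  have i1 : 1 < I.k := by omega
  have e0 := cbitM_ofFn I y ⟨0, i0⟩
  have e1 := cbitM_ofFn I y ⟨1, i1⟩
  have e1n := cbitM_nil I ⟨1, i1⟩ (m := WdS I)
  rw [phaseBitS, wdNat_encode, getD_ofFn_WdS, e0, e1, e1n, qM_ofFn]
  rcases (by omega : j = 1 ∨ j = 2 ∨ j = 3 ∨ (j = 0 ∨ 4 ≤ j)) with rfl | rfl | rfl | hj
  · simp [gS, ctl, dataW]
  · simp [gS, dat, dataW]
  · simp [gS, ctl, dataW]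
  · have h1 : j ≠ 1 := by omega
    have h2 : j ≠ 2 := by omega
    have h3 : j ≠ 3 := by omega
    have e : gS I j = fun _ => false := by
      unfold gS
      split <;> first | rfl | omega
    rcases hj with rfl | hj
    · simp [e]
    · simp [h1, h2, h3, show ¬ j ≤ 3 by omega]

/-- **The phase predicate of the specification on an instance code.** [cite: AaronsonAmbainis2018, §3.2 Prop. 6] -/
theorem PfS_encode (hk : I.k = 2) (y : QReg (Wq paramsS I.encode.length)) (j : ℕ) (hj1 : 1 ≤ j)
    (hjL : j ≤ Ly paramsS I.encode.length) :
    specS.Pf I.encode (List.ofFn y) j = (decide (j ≤ 3) && gS I j (y ∘ Fin.castLE (WdS_lt_Wq I))) := by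
  have _ := hj1
  show PfS I.encode (List.ofFn y) j = _
  rw [(Ly_paramsS _).1] at hjL
  rw [PfS, show boolPair I.encode (boolPair (List.ofFn y) (junary I.encode.length j)) = rec I.encode (List.ofFn y) I.encode.length j from rfl,
    GphaseS_apply _ _ hjL, ← phaseBitS_encode I hk y j]
  cases phaseBitS I.encode (List.ofFn y) j <;> simp

/-- **The return amplitude of the family on an instance code** is the 3-fold forrelation of the
gadget predicates on `W_d + 1` wires. [cite: AaronsonAmbainis2018, §3.2 Prop. 6] -/
theorem phiFin_encode (hk : I.k = 2) (A : Language Bool) :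
    phiFin paramsS specS I.encode A (fun _ => false) = (kForrelationValue (fun t : Fin 3 => gS I (t.val + 1)) : ℂ) :=
  phiFin_zero_eq_kForrelationValue paramsS specS I.encode A (gS I) (WdS_lt_Wq I) (three_le_Ly I) (Kv_encode I) (Wv_encode I)
    fun y j hj1 hjL => PfS_encode I hk y j hj1 hjL

/-- The three predicates as a `Fin 3`-vector. [folklore] -/
theorem gS_vec : (fun t : Fin 3 => gS I (t.val + 1)) =
    ![ctl fun w => xor (cfun I 0 w) (cfun I 1 fun _ : Fin (WdS I) => false), dat fun w => xor (cfun I 1 w) (qW I w), ctl (qW I)] := by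
  funext t
  fin_cases t <;> rfl

end SgnForrMem

/-- **Signed explicit 2-fold Forrelation** (white box): codes of instances `(n, 2, C₀, C₁)`; yes:
`B₂`-circuits with `Φ ≥ 3/5` (`IsYes`), no: `B₂`-circuits with `Φ ≤ -3/5`. The one-control-qubit
algorithm of Prop. 6 accepts with probability exactly `(1 + Φ)/2`. [cite: AaronsonAmbainis2018, §3.2 Prop. 6 and §1.1.3] -/
def signedForrelationProblem : PromiseProblem :=
  ⟨KForrelationInstance.encode '' {I | I.IsYes ∧ I.k = 2},
    KForrelationInstance.encode '' {I | (I.IsOverB2 ∧ I.value ≤ -(3 / 5 : ℝ)) ∧ I.k = 2}⟩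

end Literature.Computability.QuantumComplexity
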